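import Mathlib
import Literature.MathematicalPhysics.QuantumFieldTheory.Balaban1983to89.B7Prop2Explicit
import Literature.MathematicalPhysics.QuantumFieldTheory.Balaban1983to89.MatrixNorms

/-!
# T4AveragingDeficitWall — the NE3 energy-route WALL β TYPED over Bałaban's own one-step average (15)/(42): the defect-derivative bound (β) and the defect-value bound (β′) for the NON-LINEAR, NON-ABELIAN block average `B7Prop1Explicit.bavg` of `U(N)`-valued lattice gauge fields, as `Prop`s over the tree's definitions — STATEMENT ONLY, plus kernel certificates of the objects it quantifies over; v1.1 (append-only §8): the derivative hypothesis of (β) is satisfiable for every admissible datum, so the wall bounds an actual number (cell `pub-balaban`, T4-DAG node U1 (b), spine estimate NE3, row T4-U1b.NE3-PROVE-P2e*, GEN 5; GAPS G-ne3p2-1 «typed»)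

HONEST FRAMING (cell `pub-balaban`, T4-DAG PAGE 1).  The cell's T4 target is the existence AND uniqueness of the
continuum limit of Bałaban's unit-scale averaged loop expectations on a FINITE torus T⁴ — strictly beyond ultraviolet
stability; NO mass gap statement, NOT the Clay problem, NOT summit progress.  NE3 (U1 (b)) is the η-RATE comparison of
the minimisers of the fine Wilson action under the composite (two-level) and the one-step averaging constraints
(B11 §E).  The seat's ENERGY ROUTE (lineage modules `T4ConvexResponse` … `T4AveragingDeficitRate`) reduces NE3 to ONE
analytic input, CLAIM β of the seat's record (Appendix β §0; GAPS G-ne3p2-1): a bound on the AVERAGING DEFICIT of the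
Wilson action, `𝓓(U) = A^η(avg U) − A^{η′}(U)`, and on its first variation.  Up to this generation β was typed and
kernel-proved only for the LINEAR ABELIAN MODEL of the average (`T4AveragingDeficit*`); for Bałaban's actual average
(15) — non-linear (a `log`/`exp` of contour holonomies) and non-abelian — it existed only as prose.  THIS FILE TYPES IT:
`DeficitDerivWall` (β) and `DeficitValueWall` (β′) are `Prop`s over the tree's `B7Prop1Explicit.bavg` (B7 (15)/(42) with
the CMP-95 contours), `B7Prop1Explicit.hol`/`plaqWord` (plaquette variables (9)/(44)), `MatrixLog.mlog` (the flux, (21)),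
`UnitaryModel.nReTr` (B11 (5)'s `Re tr`) and `B7Prop2Explicit.unitaryUnits` (`G = U(N)`), in the operator norm (19)
(scope `Matrix.Norms.L2Operator`), and `ClaimBeta d N L := ∃ C a₀ R, …` is THE EXACT MISSING INEQUALITY of the NE3
energy route.  NOTHING in this file proves β: `ClaimBeta` is asserted nowhere in the package, is not a hypothesis of
any theorem here, and carries no citation — it is the seat's own conjecture-shaped wall ([analysis] content =
Appendix β §3–§6), typed so that a future proof or refutation has a kernel target.  NE3 is COND-free (no BetaPertH /
(B) / (B^μ)).

THE SETTING AND THE DICTIONARY (scale-free form).  Every ingredient of β is exactly covariant under the lattice rescaling,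
so the wall is typed ONCE, on the unit lattice `ℤ^d` of `B7Prop1Explicit` (fine spacing `1`, coarse spacing `L`, coarse
site `y` ↔ block `B(L y)`, coarse bond `⟨L y, L y + L e_κ⟩`), i.e. at Appendix β's scale pair `(η′, η) = (1/L, 1)`
transported to spacing `1`; at that pair the printed powers of `η` are all `1` and the typed form is the HOMOGENEOUS
form of (β)/(β′), which rescales to every pair `(L^{−k−1}, L^{−k})` with the same constants and implies the printed
(`η ≤ 1`-weakened) display.  Dictionary (Appendix β ↔ here; `i` absorbed, `𝔤 = 𝔲(N)` = skew-adjoint matrices):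
`U_s(b) = U(b)e^{isη′ψ(b)}` ↔ `vary V ψ s = V · expUnit (s • ψ)` (`ψ_here = iη′ψ_β`); `U(∂p′) = exp(iη′²F(p′))` ↔
`flux V p′ = mlog V(∂p′)` (`= iη′²F_β`); `(∇_U F)(b; p′) = η′⁻¹(Ad_{U(b)}F(p′+b) − F(p′))` ↔ `covGrad` (`= iη′³∇_UF_β`);
`d_Uψ` ↔ `curl` (`= iη′² d_Uψ_β`, the dressed curl CERTIFIED below as the left-trivialised derivative of the plaquette
variable); `K₀ε₁η′²` (sup of `|U(∂p′) − 1|`, (R0)–(R1)) ↔ `a` in `SmallField V a`; `𝓓` ↔ `η′^{d−4} · deficit L V W`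
(B11 (5)'s weights `ε^{d−4}`: coarse `L^{d−4}`, fine `1`); `‖·‖_{L²}`, `‖·‖_{L¹}` (unit-scale, weights `η′^d`) ↔ the plain
lattice sums `gradFluxSq`, `curlSq`, `curlL1`, `dirL1` over the `R`-neighbourhood `nbhd R` of the support (Appendix β's
`N_η(ψ)`, radius `C₁η = C₁L` fine units); `|T|` ↔ the number of coarse sites `#Y`.  Degrees: each term of (β) is
`η′^{d−4} ×` the corresponding term here times a power of `L` (absorbed in `C(d,L,N)`), e.g.
`η‖∇_UF‖_{L²}‖d_Uψ‖_{L²} = L η′^{d−4} √gradFluxSq √curlSq`, `K₀²ε₁²η‖ψ‖_{L¹} = L a² η′^{d−4} dirL1`,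
`K₀²ε₁²η²‖d_Uψ‖_{L¹} = L² a² η′^{d−4} curlL1` (the printed `η¹` on this last term is the `η ≤ 1` weakening of `η²`).
WINDOWS.  `𝓓` lives on a finite torus; here configurations live on `ℤ^d` (the consumer periodises, as everywhere in the
B7 modules) and the deficit is taken on a finite WINDOW pair `W = (W_c, W_f)`; (β) is stated for ALL SUFFICIENTLY LARGE
windows (`∀ᶠ W in atTop`, a proper filter: `window_atTop_neBot`) — for a finitely supported `ψ` only finitely many terms
of `𝓓_W(V e^{sψ})` depend on `s` (locality of (42): `V̄(c)` sees `V` on `B(c₋) ∪ B(c₊)` and the contours), so the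
derivative is eventually window-independent; (β′) is stated on the block windows `blockWindow L Y` (all coarse
plaquettes based in `Y`, all fine plaquettes based in the blocks of `Y`).  The derivative enters (β) as a `HasDerivAt`
HYPOTHESIS on `D` — no junk value of `deriv`; differentiability at `s = 0` of BOTH halves is certified here (fine:
`hasDerivAt_fineAction_vary`, every `V`, `ψ`; coarse: §8 `differentiableAt_deficit_vary` whenever every loop variable
`V(Γ_{c,x})V(c)⁻¹` of (42) lies in the analyticity ball `|· − 1| < 1` of (21), in particular — `B7Prop2Explicit.
norm_Wcx_sub_one_le`, p. 25 — throughout the small-field class with `512(d+1)(d+4)L²a ≤ 1`), so for every admissible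
datum the hypothesis is instantiated by `D = deriv (s ↦ 𝓓_W(V e^{sψ})) 0` and (β) bounds that definite number
(`exists_hasDerivAt_deficit_vary`, `DeficitDerivWall.deriv_bound`, `ClaimBeta.deriv_bound`).

CITATION HEADER (lean-in-tree rule 2026-08-18).  No sentence of any paper is used as a hypothesis, and the manuscripts
under audit are not cited for any disputed step; every `[cite:]` tag below marks a DEFINITION transcribed from print
(context), every statement of this file is [folklore] bookkeeping or a kernel-checked identity.  Context:
T. Bałaban, Commun. Math. Phys. **98** (1985) 17–51 [Balaban1985Averaging] («B7»: (8)–(9) p. 18 gauge action and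
parallel transport; (15) p. 19 and (42)–(45) pp. 23–24 the average and its covariance; (19) p. 21 operator norm;
(21)–(23) p. 21 `log`; (44) p. 24 the small-plaquette hypothesis); T. Bałaban, Commun. Math. Phys. **102** (1985)
277–309 [Balaban1985Variational] («B11»: (5) p. 278 the Wilson action `A^ε(U) = ε^{d−4} Σ_p (1 − Re tr U(∂p))`; §E
(115)–(121) p. 295, Prop. 6 — NE3's home); T. Bałaban, Commun. Math. Phys. **95** (1984) 17–40
[Balaban1984PropagatorsI] («B5»: (1.6) p. 18 blocks).
[cite: Balaban1985Averaging, (8)–(9) p.18, (15) p.19, (19) (21)–(23) p.21, (42)–(45) pp.23–24 (definitions / context);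
Balaban1985Variational, (5) p.278, (115)–(121) p.295 (definitions / context); Balaban1984PropagatorsI, (1.6) p.18]

WHAT IS TYPED (defs, [folklore] unless tagged).  §1 carriers `Site`, `Plane`, `Plaq`, `Bond`.  §2 `wt` (B11 (5)),
`fhol`, `chol` (fine / averaged-coarse plaquette variables), `fineAction`, `coarseAction`, `deficit`.  §3 `vary`, `Ad`,
`curlAt`/`curl` (dressed curl), `flux`, `covGrad`.  §4 `gradFluxSq`, `curlSq`, `curlL1`, `dirL1`, `dirSq`, `box`,
`nbhd`, `bondSites`.  §5 hypothesis classes `IsUnitaryCfg`, `IsSkewDir`, `SupportedOn`, `SmallField` (= the `h44` of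
`B7Prop1Explicit.prop1_explicit`).  §6 THE WALL: `DeficitDerivWall d N L C a₀ R` (β), `block`/`blockSites`/`blockWindow`,
`DeficitValueWall d N L C a₀ R` (β′), `ClaimBeta d N L` (∃ constants, both walls).
WHAT IS PROVED (theorems, all [folklore], sorry-free).  §7 `hasDerivAt_exp_smul_zero`, `hasDerivAt_exp_neg_smul_zero`;
`val_hol_plaqWord` (`V(∂p′) = V₁V₂V₃⁻¹V₄⁻¹`), `val_hol_vary_plaqWord`; THE CURL CERTIFICATE `hasDerivAt_hol_vary` /
`hasDerivAt_fhol_vary` (`d/ds|₀ V_s(∂p′) = (d_Vψ)(p′) · V(∂p′)` — Appendix β (L4) with the placement convention fixed by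
the kernel); `nReTrLin`/`nReTrL` (`Re tr` as a continuous `ℝ`-linear functional); THE FINE HALF OF (L5)
`hasDerivAt_wt_fhol_vary`, `hasDerivAt_fineAction_vary` (`d/ds|₀ A_W(V_s) = −Σ_{p′∈W} Re tr((d_Vψ)(p′) V(∂p′))`); flat
sanity `hol_flat`, `bavg_flat` (`avg 1 = 1`), `wt_one`, `deficit_flat` (`𝓓(1) = 0`), `flat_mem_classes`,
`zero_dir_classes`; `window_atTop_neBot`; NON-VACUITY `deficitDerivWall_zero_dir` (for every `V` and `ψ = 0` the only
admissible `D` is `0` and the bound holds), `curl_zero_dir`.  §8 (v1.1, APPEND-ONLY; §1–§7 byte-identical to v1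
p190336): differentiability along `V e^{sψ}` — `differentiableAt_exp_smul`, `differentiableAt_val_vary`(`_inv`),
`differentiableAt_val_stepHol_vary`, `differentiableAt_val_hol_vary` (transport (9) along ANY word),
`differentiableAt_val_Wcx_vary`, `differentiableAt_mlog_Wcx_vary` (via `MatrixLog.analyticAt_mlog`),
`differentiableAt_Xavg_vary`, `differentiableAt_val_bavg_vary`(`_inv`) (the average (42) and its inverse),
`differentiableAt_val_chol_vary`, `differentiableAt_wt_comp`, `differentiableAt_coarseAction_vary`,
`differentiableAt_deficit_vary`; `norm_Wcx_sub_one_lt_one_of_smallField` (inside the small-field class every loop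
variable of (42) is within `1/32` of `1` [cite: Balaban1985Averaging, p.25 (displays before (47))] = tree
`B7Prop2Explicit.norm_Wcx_sub_one_le` + `unitaryUnits ≤ U1`); `exists_hasDerivAt_deficit_vary` (THE DERIVATIVE
HYPOTHESIS OF (β) IS SATISFIABLE for every admissible datum); `DeficitDerivWall.deriv_bound` and `ClaimBeta.deriv_bound`
(the wall, if it holds, bounds `|deriv (s ↦ 𝓓_W(V e^{sψ})) 0|` eventually in `W`, with `a₁ = min(a₀, 1/(512(d+1)(d+4)L²))`).

NOT CLAIMED.  β / β′ themselves (`ClaimBeta` — [analysis], Appendix β §3–§6, GAPS G-ne3p2-1); the packaging of the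
structural right-hand side into Appendix β's `E′`-norm form `C′(K₂ + K₀²ε₁)ε₁η|N₁(ψ)|^{1/2}‖ψ‖_{E′}` (Cauchy–Schwarz plus
the (R2′) modulus `K₂ε₁` — bookkeeping left to the consumer together with the periodisation and the rescaling
dictionary above); differentiability of `s ↦ 𝓓_W(V e^{sψ})` away from `s = 0` or outside the ball of (21), and the
window-independence of its derivative (locality of (42)); gauge covariance of the typed
quantities (for `V̄` it is B7 (45) = tree `B7Prop1Explicit.bavg_gaugeAct`); anything about minimisers, B11's `H_k`,
Appendix ML, or NE3.  Intended range of the parameters: `2 ≤ L`, `2 ≤ d` (for `L ∈ {0,1}` or `d ≤ 1` the walls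
degenerate harmlessly).  Record: HOME/t4/T4-EST-NE3-P2.md v1.24 §0, Appendix β v0.11 §6.  Versions: v1 p190336
(§1–§7); v1.1 = v1 + §8 (append-only).
-/

set_option autoImplicit false

open scoped BigOperators Matrix.Norms.L2Operator
open NormedSpace Finset Filter

namespace Literature.MathematicalPhysics.QuantumFieldTheory.Balaban1983to89.T4AveragingDeficitWall

open B7Prop1Explicit B7Prop2Explicit MatrixLog UnitaryModel

noncomputable section

variable {d : ℕ} {n : Type*} [Fintype n] [DecidableEq n]

/-! ## §1 Carriers: sites, planes, plaquettes, bonds -/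

/-- The unit lattice `ℤ^d` (= `B7Prop1Explicit.Site d`; re-declared here so that the name resolves inside this
namespace). [folklore] -/
abbrev Site (d : ℕ) : Type := Fin d → ℤ

/-- An ordered coordinate plane `μ < ν` (each unoriented plaquette is counted ONCE, as in B11 (5)). [folklore] -/
abbrev Plane (d : ℕ) : Type := {a : Fin d × Fin d // a.1 < a.2}

/-- A plaquette of `ℤ^d` (fine: corner `z`; coarse: the plaquette of the `L`-lattice with corner `L • z`), with its
plane. [folklore] -/
abbrev Plaq (d : ℕ) : Type := Site d × Plane d

/-- A (positively oriented) bond `⟨x, x + e_κ⟩` of `ℤ^d`. [folklore] -/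
abbrev Bond (d : ℕ) : Type := Site d × Fin d

/-! ## §2 The Wilson actions (B11 (5)) of a configuration and of its block average (B7 (15)/(42)), and the deficit -/

/-- B11 (5): the Wilson weight `1 − Re tr W` of a plaquette variable (`tr` normalised, `tr 1 = 1`).
[cite: Balaban1985Variational, (5) p.278] -/
def wt (W : (Matrix n n ℂ)ˣ) : ℝ := 1 - nReTr (W : Matrix n n ℂ)

/-- The fine plaquette variable `V(∂p′)` (B7 (9), (44)): the holonomy of the plaquette word from the corner.
[cite: Balaban1985Averaging, (9) p.18, (44) p.24] -/
def fhol (V : Site d → Fin d → (Matrix n n ℂ)ˣ) (p : Plaq d) : (Matrix n n ℂ)ˣ :=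
  hol V p.1 (plaqWord p.2.1.1 p.2.1.2)

/-- The coarse plaquette variable `V̄(∂P)` of the AVERAGED configuration (15)/(42) `V̄ = bavg L V`, for the plaquette
of the `L`-lattice with corner `L • y`. [cite: Balaban1985Averaging, (15) p.19, (42) p.23] -/
def chol (L : ℕ) (V : Site d → Fin d → (Matrix n n ℂ)ˣ) (P : Plaq d) : (Matrix n n ℂ)ˣ :=
  cplaq L (bavg L V) ((L : ℤ) • P.1) P.2.1.1 P.2.1.2

/-- The fine Wilson action of the window `W` (a finite set of fine plaquettes), fine spacing `1`.
[cite: Balaban1985Variational, (5) p.278] -/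
def fineAction (V : Site d → Fin d → (Matrix n n ℂ)ˣ) (W : Finset (Plaq d)) : ℝ := ∑ p ∈ W, wt (fhol V p)

/-- The coarse Wilson action of the averaged configuration on the window `W` (a finite set of coarse plaquettes).
[cite: Balaban1985Variational, (5) p.278] -/
def coarseAction (L : ℕ) (V : Site d → Fin d → (Matrix n n ℂ)ˣ) (W : Finset (Plaq d)) : ℝ :=
  ∑ P ∈ W, wt (chol L V P)

/-- THE AVERAGING DEFICIT of the Wilson action on a window pair `W = (W_c, W_f)`:
`𝓓_W(V) = L^{d−4} Σ_{P ∈ W_c} (1 − Re tr V̄(∂P)) − Σ_{p′ ∈ W_f} (1 − Re tr V(∂p′))` — B11 (5)'s weights `η^{d−4}`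
with fine spacing `1` and coarse spacing `L` (record (3.3): `𝓓(U) = A^η(avg U) − A^{η′}(U)`, here `× η′^{4−d}`).
[folklore] -/
def deficit (L : ℕ) (V : Site d → Fin d → (Matrix n n ℂ)ˣ) (W : Finset (Plaq d) × Finset (Plaq d)) : ℝ :=
  (L : ℝ) ^ ((d : ℤ) - 4) * coarseAction L V W.1 - fineAction V W.2

/-! ## §3 Perturbations, the dressed curl, the flux and its covariant gradient -/

/-- The one-parameter perturbation `V_s(b) = V(b) e^{s ψ(b)}` of Appendix β §0 (`U_s(b) = U(b)e^{isη′ψ(b)}`, the `i`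
and the `η′` absorbed into `ψ`). [folklore] -/
def vary (V : Site d → Fin d → (Matrix n n ℂ)ˣ) (ψ : Site d → Fin d → Matrix n n ℂ) (s : ℝ) :
    Site d → Fin d → (Matrix n n ℂ)ˣ :=
  fun x μ => V x μ * expUnit ((s : ℂ) • ψ x μ)

/-- `Ad_u X = u X u⁻¹`. [folklore] -/
def Ad (u : (Matrix n n ℂ)ˣ) (X : Matrix n n ℂ) : Matrix n n ℂ :=
  (u : Matrix n n ℂ) * X * ((u⁻¹ : (Matrix n n ℂ)ˣ) : Matrix n n ℂ)

/-- THE DRESSED CURL `(d_V ψ)(p′)` of a direction field at the plaquette `p′ = (z; μ < ν)`: the left-trivialised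
derivative of the plaquette variable, `d/ds|₀ V_s(∂p′) = (d_V ψ)(p′) · V(∂p′)` (`hasDerivAt_fhol_vary`):
`Ad_{V₁} ψ₁ + Ad_{V₁V₂} ψ₂ − Ad_{V₁V₂} ψ₃ − Ad_{V₁V₂V₃⁻¹} ψ₄` for the four bonds of `∂p′` in the order of the word
(Appendix β (L3)/(L4), placement convention fixed by the lemma). [folklore] -/
def curlAt (V : Site d → Fin d → (Matrix n n ℂ)ˣ) (ψ : Site d → Fin d → Matrix n n ℂ) (z : Site d) (μ ν : Fin d) :
    Matrix n n ℂ :=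
  Ad (V z μ) (ψ z μ) + Ad (V z μ * V (z + e μ) ν) (ψ (z + e μ) ν)
    - Ad (V z μ * V (z + e μ) ν) (ψ (z + e ν) μ) - Ad (V z μ * V (z + e μ) ν * (V (z + e ν) μ)⁻¹) (ψ z ν)

/-- The dressed curl on indexed plaquettes. [folklore] -/
def curl (V : Site d → Fin d → (Matrix n n ℂ)ˣ) (ψ : Site d → Fin d → Matrix n n ℂ) (p : Plaq d) : Matrix n n ℂ :=
  curlAt V ψ p.1 p.2.1.1 p.2.1.2

/-- THE FLUX `F(p′) = log V(∂p′)` of a fine plaquette (B7 (21): the series `mlog`, the principal logarithm when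
`|V(∂p′) − 1| < 1`; Appendix β (R0): `U(∂p′) = exp(iη′²F(p′))`). [cite: Balaban1985Averaging, (21) p.21] -/
def flux (V : Site d → Fin d → (Matrix n n ℂ)ˣ) (p : Plaq d) : Matrix n n ℂ :=
  mlog ((fhol V p : (Matrix n n ℂ)ˣ) : Matrix n n ℂ)

/-- THE COVARIANT FORWARD GRADIENT of a plaquette function along the bond `⟨x, x + e_κ⟩`:
`(∇_V F)(x, κ; π) = Ad_{V(x,κ)} F(x + e_κ; π) − F(x; π)` (Appendix β (R2′): `Ad_{U(b)}F(p′ + b) − F(p′)`, here for the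
plaquettes based at `b₋`). [folklore] -/
def covGrad (V : Site d → Fin d → (Matrix n n ℂ)ˣ) (F : Plaq d → Matrix n n ℂ) (x : Site d) (κ : Fin d)
    (π : Plane d) : Matrix n n ℂ :=
  Ad (V x κ) (F (x + e κ, π)) - F (x, π)

/-! ## §4 The norm functionals of the wall (operator norm (19) throughout) and neighbourhoods -/

/-- `Σ_{x ∈ N} Σ_κ Σ_π |(∇_V F)(x, κ; π)|²` — the squared `ℓ²(N)` norm of the covariant gradient of the flux
(Appendix β: `‖∇_U F‖²_{L²(N)}`, here `× η′^{6−d}`). [folklore] -/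
def gradFluxSq (V : Site d → Fin d → (Matrix n n ℂ)ˣ) (N : Finset (Site d)) : ℝ :=
  ∑ x ∈ N, ∑ κ : Fin d, ∑ π : Plane d, ‖covGrad V (flux V) x κ π‖ ^ 2

/-- `Σ_{z ∈ N} Σ_π |(d_V ψ)(z; π)|²` (Appendix β: `‖d_U ψ‖²_{L²}`, here `× η′^{4−d}`). [folklore] -/
def curlSq (V : Site d → Fin d → (Matrix n n ℂ)ˣ) (ψ : Site d → Fin d → Matrix n n ℂ) (N : Finset (Site d)) : ℝ :=
  ∑ z ∈ N, ∑ π : Plane d, ‖curl V ψ (z, π)‖ ^ 2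

/-- `Σ_{z ∈ N} Σ_π |(d_V ψ)(z; π)|` (Appendix β: `‖d_U ψ‖_{L¹}`, here `× η′^{2−d}`). [folklore] -/
def curlL1 (V : Site d → Fin d → (Matrix n n ℂ)ˣ) (ψ : Site d → Fin d → Matrix n n ℂ) (N : Finset (Site d)) : ℝ :=
  ∑ z ∈ N, ∑ π : Plane d, ‖curl V ψ (z, π)‖

/-- `Σ_{x ∈ N} Σ_κ |ψ(x, κ)|` (Appendix β: `‖ψ‖_{L¹}`, here `× η′^{1−d}`). [folklore] -/
def dirL1 (ψ : Site d → Fin d → Matrix n n ℂ) (N : Finset (Site d)) : ℝ := ∑ x ∈ N, ∑ κ : Fin d, ‖ψ x κ‖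

/-- `Σ_{x ∈ N} Σ_κ |ψ(x, κ)|²` (Appendix β: `‖ψ‖²_{L²}`, here `× η′^{2−d}`). [folklore] -/
def dirSq (ψ : Site d → Fin d → Matrix n n ℂ) (N : Finset (Site d)) : ℝ := ∑ x ∈ N, ∑ κ : Fin d, ‖ψ x κ‖ ^ 2

/-- The `ℓ^∞` box of radius `R` around `y`. [folklore] -/
def box (R : ℕ) (y : Site d) : Finset (Site d) := Finset.Icc (y - fun _ => (R : ℤ)) (y + fun _ => (R : ℤ))

/-- The `R`-neighbourhood of a finite set of sites. [folklore] -/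
def nbhd (R : ℕ) (T : Finset (Site d)) : Finset (Site d) := T.biUnion (box R)

/-- The sites of a finite set of bonds (their initial points). [folklore] -/
def bondSites (S : Finset (Bond d)) : Finset (Site d) := S.image Prod.fst

/-! ## §5 The hypothesis classes -/

/-- `U(N)`-valued configurations (B7 p. 18 «gauge field configurations with values in `U(N)`»).
[cite: Balaban1985Averaging, p.18] -/
def IsUnitaryCfg (V : Site d → Fin d → (Matrix n n ℂ)ˣ) : Prop := ∀ x κ, V x κ ∈ unitaryUnits (Matrix n n ℂ)

/-- `𝔲(N)`-valued (skew-adjoint) direction fields — the Lie algebra directions `e^{sψ} ∈ U(N)` (B7 (22)–(23):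
`log U = iA`, `A` hermitian). [cite: Balaban1985Averaging, (22)–(23) p.21] -/
def IsSkewDir (ψ : Site d → Fin d → Matrix n n ℂ) : Prop := ∀ x κ, ψ x κ ∈ skewAdjoint (Matrix n n ℂ)

/-- Finite support of a direction field inside the bond set `S`. [folklore] -/
def SupportedOn (ψ : Site d → Fin d → Matrix n n ℂ) (S : Finset (Bond d)) : Prop := ∀ x κ, (x, κ) ∉ S → ψ x κ = 0

/-- THE SMALL-FIELD CLASS (44)/(R0)–(R1): every fine plaquette variable of `ℤ^d` is within `a` of `1` in the
operator norm (19) (`a` = Appendix β's `K₀ε₁η′²`; exactly the hypothesis `h44` of `B7Prop1Explicit.prop1_explicit`).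
[cite: Balaban1985Averaging, (44) p.24] -/
def SmallField (V : Site d → Fin d → (Matrix n n ℂ)ˣ) (a : ℝ) : Prop :=
  ∀ (x : Site d) (κ κ' : Fin d), κ ≠ κ' → ‖((hol V x (plaqWord κ κ') : (Matrix n n ℂ)ˣ) : Matrix n n ℂ) - 1‖ ≤ a

/-! ## §6 THE WALL, typed: β (derivative) and β′ (value) in scale-free structural form -/

variable (d n) in
/-- **THE WALL β (Appendix β (β), record (3.4); GAPS G-ne3p2-1), TYPED** for the non-abelian average (15)/(42) with
constants `C, a₀, R`: for every `U(N)`-valued `V` on `ℤ^d` in the small-field class `SmallField V a`, `0 ≤ a ≤ a₀`,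
every finitely supported `𝔲(N)`-valued direction `ψ` (support in the bond set `S`), and ALL SUFFICIENTLY LARGE WINDOWS
`W` (so that `d/ds 𝓓_W(V_s)` is the full derivative), every derivative `D` of `s ↦ 𝓓_W(V e^{sψ})` at `s = 0` obeys
`|D| ≤ C · [ ‖∇_V F‖_{ℓ²(N_R)} · ‖d_V ψ‖_{ℓ²(N_R)} + a² (‖ψ‖_{ℓ¹(N_R)} + ‖d_V ψ‖_{ℓ¹(N_R)}) ]`, `N_R` the
`R`-neighbourhood of the support — the scale-free form of
`|d/ds|₀ 𝓓(U_s)| ≤ C(d,L,N)[η‖∇_U F‖_{L²(N_η(ψ))}‖d_Uψ‖_{L²} + K₀²ε₁²(η‖ψ‖_{L¹} + η²‖d_Uψ‖_{L¹})]`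
(homogeneous form; Appendix β prints `η¹` on the last term, the `η ≤ 1` weakening — see the header DICTIONARY).
The derivative enters as a `HasDerivAt` HYPOTHESIS (no junk value of `deriv`). [folklore] -/
def DeficitDerivWall (L : ℕ) (C a₀ : ℝ) (R : ℕ) : Prop :=
  ∀ (V : Site d → Fin d → (Matrix n n ℂ)ˣ), IsUnitaryCfg V →
  ∀ (a : ℝ), 0 ≤ a → a ≤ a₀ → SmallField V a →
  ∀ (ψ : Site d → Fin d → Matrix n n ℂ) (S : Finset (Bond d)), IsSkewDir ψ → SupportedOn ψ S →
  ∀ᶠ W in (atTop : Filter (Finset (Plaq d) × Finset (Plaq d))),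
    ∀ D : ℝ, HasDerivAt (fun s : ℝ => deficit L (vary V ψ s) W) D 0 →
      |D| ≤ C * (Real.sqrt (gradFluxSq V (nbhd R (bondSites S))) * Real.sqrt (curlSq V ψ (nbhd R (bondSites S)))
        + a ^ 2 * (dirL1 ψ (nbhd R (bondSites S)) + curlL1 V ψ (nbhd R (bondSites S))))

/-- The block `B(L y) = {L y + r : r ∈ [0, L)^d}` of the coarse site `y` (B5 (1.6)). [cite: Balaban1984PropagatorsI, (1.6) p.18] -/
def block (L : ℕ) (y : Site d) : Finset (Site d) :=
  Finset.univ.image fun r : Fin d → Fin L => (L : ℤ) • y + boxVec L r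

/-- The fine sites of the blocks of a finite set `Y` of coarse sites. [folklore] -/
def blockSites (L : ℕ) (Y : Finset (Site d)) : Finset (Site d) := Y.biUnion (block L)

/-- The window pair of a finite set `Y` of coarse sites: all coarse plaquettes based in `Y`, all fine plaquettes
based in the blocks of `Y` (the region-wise reading of `A^η(avg U) − A^{η′}(U)`). [folklore] -/
def blockWindow (L : ℕ) (Y : Finset (Site d)) : Finset (Plaq d) × Finset (Plaq d) :=
  (Y ×ˢ Finset.univ, blockSites L Y ×ˢ Finset.univ)

variable (d n) in
/-- **THE VALUE WALL β′ (Appendix β (β′), record (3.3)), TYPED**: for every `U(N)`-valued `V` in `SmallField V a`,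
`0 ≤ a ≤ a₀`, and every finite set `Y` of coarse sites,
`|𝓓_{W(Y)}(V)| ≤ C · [ ‖∇_V F‖²_{ℓ²(N_R(blocks of Y))} + a³ · #Y ]` — the scale-free form of
`|𝓓(U)| ≤ C(d,L,N)[η²‖∇_U F‖²_{L²} + (K₀³ε₁ + K₀⁴ε₁²η²)ε₁²η²|T|]` (the `a⁴` term is absorbed in `a³`, `a ≤ a₀ ≤ 1`).
[folklore] -/
def DeficitValueWall (L : ℕ) (C a₀ : ℝ) (R : ℕ) : Prop :=
  ∀ (V : Site d → Fin d → (Matrix n n ℂ)ˣ), IsUnitaryCfg V →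
  ∀ (a : ℝ), 0 ≤ a → a ≤ a₀ → SmallField V a →
  ∀ (Y : Finset (Site d)),
    |deficit L V (blockWindow L Y)| ≤ C * (gradFluxSq V (nbhd R (blockSites L Y)) + a ^ 3 * Y.card)

variable (d n) in
/-- **CLAIM β / β′ of the lineage (Appendix β §0), as ONE typed statement**: there are constants `C ≥ 0`,
`0 < a₀ ≤ 1`, `R` — depending on `d`, `N` and `L` only — for which both walls hold.  ASSERTED NOWHERE in this package;
its proof is Appendix β §3–§6 [analysis]. [folklore] -/
def ClaimBeta (L : ℕ) : Prop :=
  ∃ C a₀ : ℝ, ∃ R : ℕ, 0 ≤ C ∧ 0 < a₀ ∧ a₀ ≤ 1 ∧ DeficitDerivWall d n L C a₀ R ∧ DeficitValueWall d n L C a₀ R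

/-! ## §7 Kernel certificates: the dressed curl IS the derivative of the plaquette variable; flat sanity;
non-vacuity of the eventuality -/

/-- `d/ds|₀ e^{sX} = X` along the real line. [folklore] -/
theorem hasDerivAt_exp_smul_zero (X : Matrix n n ℂ) :
    HasDerivAt (fun s : ℝ => exp ((s : ℂ) • X)) X 0 := by
  have h := hasDerivAt_exp_smul_const' (𝕂 := ℝ) X (0 : ℝ)
  simp only [zero_smul, exp_zero, mul_one] at h
  refine h.congr_of_eventuallyEq (Filter.Eventually.of_forall fun s => ?_)
  simp only [Complex.coe_smul]

/-- `d/ds|₀ e^{−sX} = −X`. [folklore] -/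
theorem hasDerivAt_exp_neg_smul_zero (X : Matrix n n ℂ) :
    HasDerivAt (fun s : ℝ => exp (-((s : ℂ) • X))) (-X) 0 := by
  have h := hasDerivAt_exp_smul_zero (-X)
  simp only [smul_neg] at h
  exact h

/-- The plaquette variable written out: `V(∂p′) = V₁ V₂ V₃⁻¹ V₄⁻¹`. [folklore] -/
theorem val_hol_plaqWord (V : Site d → Fin d → (Matrix n n ℂ)ˣ) (z : Site d) (μ ν : Fin d) :
    ((hol V z (plaqWord μ ν) : (Matrix n n ℂ)ˣ) : Matrix n n ℂ)
      = (V z μ : Matrix n n ℂ) * ((V (z + e μ) ν : Matrix n n ℂ)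
          * ((((V (z + e ν) μ)⁻¹ : (Matrix n n ℂ)ˣ) : Matrix n n ℂ) * (((V z ν)⁻¹ : (Matrix n n ℂ)ˣ) : Matrix n n ℂ))) := by
  simp only [plaqWord, hol_cons, hol_nil, mul_one, stepHol_true, stepHol_false, Letter.vec_true, Letter.vec_false,
    Units.val_mul]
  abel_nf

/-- The perturbed plaquette variable written out: `V_s(∂p′) = V₁e^{sψ₁} · V₂e^{sψ₂} · e^{−sψ₃}V₃⁻¹ · e^{−sψ₄}V₄⁻¹`.
[folklore] -/
theorem val_hol_vary_plaqWord (V : Site d → Fin d → (Matrix n n ℂ)ˣ) (ψ : Site d → Fin d → Matrix n n ℂ)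
    (z : Site d) (μ ν : Fin d) (s : ℝ) :
    ((hol (vary V ψ s) z (plaqWord μ ν) : (Matrix n n ℂ)ˣ) : Matrix n n ℂ)
      = ((V z μ : Matrix n n ℂ) * exp ((s : ℂ) • ψ z μ))
        * (((V (z + e μ) ν : Matrix n n ℂ) * exp ((s : ℂ) • ψ (z + e μ) ν))
          * ((exp (-((s : ℂ) • ψ (z + e ν) μ)) * (((V (z + e ν) μ)⁻¹ : (Matrix n n ℂ)ˣ) : Matrix n n ℂ))
            * (exp (-((s : ℂ) • ψ z ν)) * (((V z ν)⁻¹ : (Matrix n n ℂ)ˣ) : Matrix n n ℂ)))) := by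
  rw [val_hol_plaqWord]
  simp only [vary, mul_inv_rev, Units.val_mul, val_inv_expUnit, val_expUnit, mul_assoc]

/-- **THE DRESSED CURL IS THE LEFT-TRIVIALISED DERIVATIVE OF THE PLAQUETTE VARIABLE**:
`d/ds|₀ V_s(∂p′) = (d_V ψ)(p′) · V(∂p′)` for `V_s = V e^{sψ}` (Appendix β (L4) with the placement fixed).
[folklore] -/
theorem hasDerivAt_hol_vary (V : Site d → Fin d → (Matrix n n ℂ)ˣ) (ψ : Site d → Fin d → Matrix n n ℂ)
    (z : Site d) (μ ν : Fin d) :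
    HasDerivAt (fun s : ℝ => ((hol (vary V ψ s) z (plaqWord μ ν) : (Matrix n n ℂ)ˣ) : Matrix n n ℂ))
      (curlAt V ψ z μ ν * ((hol V z (plaqWord μ ν) : (Matrix n n ℂ)ˣ) : Matrix n n ℂ)) 0 := by
  have h1 : HasDerivAt (fun s : ℝ => ((V z μ) : Matrix n n ℂ) * exp ((s : ℂ) • (ψ z μ))) (((V z μ) : Matrix n n ℂ) * (ψ z μ)) 0 :=
    (hasDerivAt_exp_smul_zero (ψ z μ)).const_mul _
  have h2 : HasDerivAt (fun s : ℝ => ((V (z + e μ) ν) : Matrix n n ℂ) * exp ((s : ℂ) • (ψ (z + e μ) ν))) (((V (z + e μ) ν) : Matrix n n ℂ) * (ψ (z + e μ) ν)) 0 :=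
    (hasDerivAt_exp_smul_zero (ψ (z + e μ) ν)).const_mul _
  have h3 : HasDerivAt (fun s : ℝ => exp (-((s : ℂ) • (ψ (z + e ν) μ))) * ((((V (z + e ν) μ))⁻¹ : (Matrix n n ℂ)ˣ) : Matrix n n ℂ))
      (-(ψ (z + e ν) μ) * ((((V (z + e ν) μ))⁻¹ : (Matrix n n ℂ)ˣ) : Matrix n n ℂ)) 0 :=
    (hasDerivAt_exp_neg_smul_zero (ψ (z + e ν) μ)).mul_const _
  have h4 : HasDerivAt (fun s : ℝ => exp (-((s : ℂ) • (ψ z ν))) * ((((V z ν))⁻¹ : (Matrix n n ℂ)ˣ) : Matrix n n ℂ))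
      (-(ψ z ν) * ((((V z ν))⁻¹ : (Matrix n n ℂ)ˣ) : Matrix n n ℂ)) 0 :=
    (hasDerivAt_exp_neg_smul_zero (ψ z ν)).mul_const _
  have H := h1.mul (h2.mul (h3.mul h4))
  have H' : HasDerivAt (fun s : ℝ => ((hol (vary V ψ s) z (plaqWord μ ν) : (Matrix n n ℂ)ˣ) : Matrix n n ℂ))
      (((V z μ) : Matrix n n ℂ) * (ψ z μ) *
          (((V (z + e μ) ν) : Matrix n n ℂ) * exp (((0 : ℝ) : ℂ) • (ψ (z + e μ) ν)) *
            (exp (-(((0 : ℝ) : ℂ) • (ψ (z + e ν) μ))) * ((((V (z + e ν) μ))⁻¹ : (Matrix n n ℂ)ˣ) : Matrix n n ℂ) *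
              (exp (-(((0 : ℝ) : ℂ) • (ψ z ν))) * ((((V z ν))⁻¹ : (Matrix n n ℂ)ˣ) : Matrix n n ℂ)))) +
        ((V z μ) : Matrix n n ℂ) * exp (((0 : ℝ) : ℂ) • (ψ z μ)) *
          (((V (z + e μ) ν) : Matrix n n ℂ) * (ψ (z + e μ) ν) *
              (exp (-(((0 : ℝ) : ℂ) • (ψ (z + e ν) μ))) * ((((V (z + e ν) μ))⁻¹ : (Matrix n n ℂ)ˣ) : Matrix n n ℂ) *
                (exp (-(((0 : ℝ) : ℂ) • (ψ z ν))) * ((((V z ν))⁻¹ : (Matrix n n ℂ)ˣ) : Matrix n n ℂ))) +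
            ((V (z + e μ) ν) : Matrix n n ℂ) * exp (((0 : ℝ) : ℂ) • (ψ (z + e μ) ν)) *
              (-(ψ (z + e ν) μ) * ((((V (z + e ν) μ))⁻¹ : (Matrix n n ℂ)ˣ) : Matrix n n ℂ) *
                  (exp (-(((0 : ℝ) : ℂ) • (ψ z ν))) * ((((V z ν))⁻¹ : (Matrix n n ℂ)ˣ) : Matrix n n ℂ)) +
                exp (-(((0 : ℝ) : ℂ) • (ψ (z + e ν) μ))) * ((((V (z + e ν) μ))⁻¹ : (Matrix n n ℂ)ˣ) : Matrix n n ℂ) *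
                  (-(ψ z ν) * ((((V z ν))⁻¹ : (Matrix n n ℂ)ˣ) : Matrix n n ℂ))))) 0 := by
    refine H.congr_of_eventuallyEq (Filter.Eventually.of_forall fun s => ?_)
    simp only [Pi.mul_apply]
    rw [val_hol_vary_plaqWord]
  refine H'.congr_deriv ?_
  simp only [Complex.ofReal_zero, zero_smul, neg_zero, exp_zero, mul_one, one_mul]
  rw [val_hol_plaqWord]
  simp only [curlAt, Ad, Units.val_mul, mul_inv_rev, inv_inv, add_mul, sub_mul, mul_add, neg_mul, mul_neg, mul_assoc,
    Units.inv_mul_cancel_left, Units.mul_inv_cancel_left]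
  abel

/-- The same on indexed plaquettes: `d/ds|₀ V_s(∂p′) = (d_V ψ)(p′) · V(∂p′)`. [folklore] -/
theorem hasDerivAt_fhol_vary (V : Site d → Fin d → (Matrix n n ℂ)ˣ) (ψ : Site d → Fin d → Matrix n n ℂ)
    (p : Plaq d) :
    HasDerivAt (fun s : ℝ => ((fhol (vary V ψ s) p : (Matrix n n ℂ)ˣ) : Matrix n n ℂ))
      (curl V ψ p * ((fhol V p : (Matrix n n ℂ)ˣ) : Matrix n n ℂ)) 0 :=
  hasDerivAt_hol_vary V ψ p.1 p.2.1.1 p.2.1.2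

/-! ### The fine half of Appendix β (L5): `d/ds|₀ Σ_{p′} (1 − Re tr V_s(∂p′)) = − Σ_{p′} Re tr((d_V ψ)(p′) V(∂p′))` -/

/-- `Re tr` (normalised, B12 (0.2)) as an `ℝ`-linear functional on `M_N(ℂ)`. [folklore] -/
def nReTrLin : Matrix n n ℂ →ₗ[ℝ] ℝ where
  toFun := nReTr
  map_add' X Y := by
    simp only [nReTr, Matrix.trace_add, Complex.add_re, add_div]
  map_smul' c X := by
    simp only [nReTr, Matrix.trace_smul, Complex.smul_re, smul_eq_mul, RingHom.id_apply, mul_div_assoc]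

/-- `Re tr` as a CONTINUOUS `ℝ`-linear functional (finite dimension). [folklore] -/
def nReTrL : Matrix n n ℂ →L[ℝ] ℝ := LinearMap.toContinuousLinearMap nReTrLin

omit [DecidableEq n] in
/-- `nReTrL X = Re tr X`. [folklore] -/
@[simp] theorem nReTrL_apply (X : Matrix n n ℂ) : nReTrL X = nReTr X := rfl

/-- **The derivative of one Wilson weight** along `V_s = V e^{sψ}`:
`d/ds|₀ (1 − Re tr V_s(∂p′)) = − Re tr((d_V ψ)(p′) · V(∂p′))`. [folklore] -/
theorem hasDerivAt_wt_fhol_vary (V : Site d → Fin d → (Matrix n n ℂ)ˣ) (ψ : Site d → Fin d → Matrix n n ℂ)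
    (p : Plaq d) :
    HasDerivAt (fun s : ℝ => wt (fhol (vary V ψ s) p))
      (-nReTr (curl V ψ p * ((fhol V p : (Matrix n n ℂ)ˣ) : Matrix n n ℂ))) 0 := by
  have h := ((nReTrL (n := n)).hasFDerivAt.comp_hasDerivAt (0 : ℝ) (hasDerivAt_fhol_vary V ψ p)).const_sub 1
  simpa [wt, Function.comp_def] using h

/-- **The fine half of (L5)**: `d/ds|₀ A_{W}(V_s) = − Σ_{p′ ∈ W} Re tr((d_V ψ)(p′) · V(∂p′))` for every finite window
of fine plaquettes — the dressed curl paired with the plaquette variables (at a flat `V` this is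
`− Σ Re tr (d_Vψ) = 0` for skew `ψ`: the fine action is critical at flat configurations). [folklore] -/
theorem hasDerivAt_fineAction_vary (V : Site d → Fin d → (Matrix n n ℂ)ˣ) (ψ : Site d → Fin d → Matrix n n ℂ)
    (W : Finset (Plaq d)) :
    HasDerivAt (fun s : ℝ => fineAction (vary V ψ s) W)
      (-∑ p ∈ W, nReTr (curl V ψ p * ((fhol V p : (Matrix n n ℂ)ˣ) : Matrix n n ℂ))) 0 := by
  have h := HasDerivAt.sum (u := W) (x := (0 : ℝ)) (A := fun p s => wt (fhol (vary V ψ s) p))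
    (A' := fun p => -nReTr (curl V ψ p * ((fhol V p : (Matrix n n ℂ)ˣ) : Matrix n n ℂ)))
    fun p _ => hasDerivAt_wt_fhol_vary V ψ p
  simpa [fineAction, Finset.sum_fn] using h

/-! ### Flat sanity -/

/-- `e^0 = 1` as a unit. [folklore] -/
@[simp] theorem expUnit_zero : (expUnit (0 : Matrix n n ℂ)) = 1 := by
  ext; simp

/-- `V_0 = V`. [folklore] -/
@[simp] theorem vary_zero (V : Site d → Fin d → (Matrix n n ℂ)ˣ) (ψ : Site d → Fin d → Matrix n n ℂ) :
    vary V ψ 0 = V := by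
  funext x μ; simp [vary]

/-- Bonds off the support are not varied. [folklore] -/
theorem vary_eq_of_eq_zero (V : Site d → Fin d → (Matrix n n ℂ)ˣ) {ψ : Site d → Fin d → Matrix n n ℂ}
    {x : Site d} {κ : Fin d} (h : ψ x κ = 0) (s : ℝ) : vary V ψ s x κ = V x κ := by
  simp [vary, h]

/-- The holonomy of the flat configuration `V ≡ 1` along any word is `1`. [folklore] -/
theorem hol_flat (x : Site d) (w : List (Letter d)) :
    hol (fun (_ : Site d) (_ : Fin d) => (1 : (Matrix n n ℂ)ˣ)) x w = 1 := by
  induction w generalizing x with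
  | nil => rfl
  | cons l w ih =>
    rw [hol_cons, ih]
    unfold stepHol
    split <;> simp

/-- The average (15)/(42) of the flat configuration is flat: `bavg L 1 = 1`. [folklore] -/
theorem bavg_flat (L : ℕ) : bavg L (fun (_ : Site d) (_ : Fin d) => (1 : (Matrix n n ℂ)ˣ)) = fun _ _ => 1 := by
  funext q κ
  have hX : Xavg L (fun (_ : Site d) (_ : Fin d) => (1 : (Matrix n n ℂ)ˣ)) q κ = 0 := by
    unfold Xavg Wcx
    simp [hol_flat]
  unfold bavg
  rw [hX, hol_flat, expUnit_zero, mul_one]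

/-- The Wilson weight of `1` vanishes. [folklore] -/
theorem wt_one [Nonempty n] : wt (1 : (Matrix n n ℂ)ˣ) = 0 := by
  simp [wt, nReTr_one]

/-- The deficit of the flat configuration vanishes on every window. [folklore] -/
theorem deficit_flat [Nonempty n] (L : ℕ) (W : Finset (Plaq d) × Finset (Plaq d)) :
    deficit L (fun (_ : Site d) (_ : Fin d) => (1 : (Matrix n n ℂ)ˣ)) W = 0 := by
  have hc : ∀ P : Plaq d, chol L (fun (_ : Site d) (_ : Fin d) => (1 : (Matrix n n ℂ)ˣ)) P = 1 := by
    intro P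
    unfold chol
    rw [bavg_flat]
    simp [cplaq]
  have hf : ∀ p : Plaq d, fhol (fun (_ : Site d) (_ : Fin d) => (1 : (Matrix n n ℂ)ˣ)) p = 1 := fun p =>
    hol_flat _ _
  simp [deficit, coarseAction, fineAction, hc, hf, wt_one]

/-- The flat configuration is unitary and lies in every small-field class. [folklore] -/
theorem flat_mem_classes {a : ℝ} (ha : 0 ≤ a) :
    IsUnitaryCfg (fun (_ : Site d) (_ : Fin d) => (1 : (Matrix n n ℂ)ˣ))
      ∧ SmallField (fun (_ : Site d) (_ : Fin d) => (1 : (Matrix n n ℂ)ˣ)) a := by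
  refine ⟨fun x κ => (unitaryUnits (Matrix n n ℂ)).one_mem, fun x κ κ' _ => ?_⟩
  rw [hol_flat]
  simpa using ha

omit [Fintype n] [DecidableEq n] in
/-- The zero direction is skew and supported anywhere. [folklore] -/
theorem zero_dir_classes (S : Finset (Bond d)) :
    IsSkewDir (fun (_ : Site d) (_ : Fin d) => (0 : Matrix n n ℂ))
      ∧ SupportedOn (fun (_ : Site d) (_ : Fin d) => (0 : Matrix n n ℂ)) S :=
  ⟨fun _ _ => (skewAdjoint (Matrix n n ℂ)).zero_mem, fun _ _ _ => rfl⟩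

/-- The window filter is proper: «for all sufficiently large windows» is never vacuous. [folklore] -/
theorem window_atTop_neBot : (atTop : Filter (Finset (Plaq d) × Finset (Plaq d))).NeBot := atTop_neBot

/-- The zero direction does not move the configuration. [folklore] -/
@[simp] theorem vary_zero_dir (V : Site d → Fin d → (Matrix n n ℂ)ˣ) (s : ℝ) :
    vary V (fun (_ : Site d) (_ : Fin d) => (0 : Matrix n n ℂ)) s = V := by
  funext x κ; simp [vary]

/-- NON-VACUITY of the typed wall along the zero direction: for EVERY configuration `V` and `ψ = 0` the only
admissible `D` is `0`, and the bound holds for every `C ≥ 0` (so `DeficitDerivWall` is not refuted by a junk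
derivative, and its conclusion is homogeneous of the right degree in `ψ` at `ψ = 0`). [folklore] -/
theorem deficitDerivWall_zero_dir (L : ℕ) {C : ℝ} (hC : 0 ≤ C) (V : Site d → Fin d → (Matrix n n ℂ)ˣ) (a : ℝ)
    (R : ℕ) (S : Finset (Bond d)) (W : Finset (Plaq d) × Finset (Plaq d)) (D : ℝ)
    (hD : HasDerivAt (fun s : ℝ => deficit L (vary V (fun (_ : Site d) (_ : Fin d) => (0 : Matrix n n ℂ)) s) W)
      D 0) :
    |D| ≤ C * (Real.sqrt (gradFluxSq V (nbhd R (bondSites S)))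
        * Real.sqrt (curlSq V (fun (_ : Site d) (_ : Fin d) => (0 : Matrix n n ℂ)) (nbhd R (bondSites S)))
      + a ^ 2 * (dirL1 (fun (_ : Site d) (_ : Fin d) => (0 : Matrix n n ℂ)) (nbhd R (bondSites S))
        + curlL1 V (fun (_ : Site d) (_ : Fin d) => (0 : Matrix n n ℂ)) (nbhd R (bondSites S)))) := by
  simp only [vary_zero_dir] at hD
  have hD0 : D = 0 := hD.unique (hasDerivAt_const (0 : ℝ) (deficit L V W))
  subst hD0
  rw [abs_zero]
  refine mul_nonneg hC (add_nonneg (mul_nonneg (Real.sqrt_nonneg _) (Real.sqrt_nonneg _))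
    (mul_nonneg (sq_nonneg a) (add_nonneg ?_ ?_)))
  · exact Finset.sum_nonneg fun _ _ => Finset.sum_nonneg fun _ _ => norm_nonneg _
  · exact Finset.sum_nonneg fun _ _ => Finset.sum_nonneg fun _ _ => norm_nonneg _

/-- The dressed curl of the zero direction vanishes. [folklore] -/
@[simp] theorem curl_zero_dir (V : Site d → Fin d → (Matrix n n ℂ)ˣ) (p : Plaq d) :
    curl V (fun (_ : Site d) (_ : Fin d) => (0 : Matrix n n ℂ)) p = 0 := by
  simp [curl, curlAt, Ad]

/-! ## §8 (v1.1, append-only) The derivative hypothesis of (β) is always satisfiable: differentiability of the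
deficit along every perturbation `V e^{sψ}` inside the small-field class, hence (β) bounds a definite number -/

/-- `s ↦ e^{sX}` is differentiable at every `s`. [folklore] -/
theorem differentiableAt_exp_smul (X : Matrix n n ℂ) (s : ℝ) :
    DifferentiableAt ℝ (fun s : ℝ => exp ((s : ℂ) • X)) s := by
  have h := hasDerivAt_exp_smul_const' (𝕂 := ℝ) X s
  refine (h.congr_of_eventuallyEq ?_).differentiableAt
  exact Filter.Eventually.of_forall fun u => by simp only [Complex.coe_smul]

/-- `s ↦ V(b) e^{sψ(b)}` is differentiable. [folklore] -/
theorem differentiableAt_val_vary (V : Site d → Fin d → (Matrix n n ℂ)ˣ) (ψ : Site d → Fin d → Matrix n n ℂ)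
    (x : Site d) (μ : Fin d) (s : ℝ) :
    DifferentiableAt ℝ (fun s : ℝ => ((vary V ψ s x μ : (Matrix n n ℂ)ˣ) : Matrix n n ℂ)) s := by
  simp only [vary, Units.val_mul, val_expUnit]
  exact (differentiableAt_exp_smul (ψ x μ) s).const_mul _

/-- `s ↦ (V(b) e^{sψ(b)})⁻¹ = e^{−sψ(b)} V(b)⁻¹` is differentiable. [folklore] -/
theorem differentiableAt_val_vary_inv (V : Site d → Fin d → (Matrix n n ℂ)ˣ) (ψ : Site d → Fin d → Matrix n n ℂ)
    (x : Site d) (μ : Fin d) (s : ℝ) :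
    DifferentiableAt ℝ (fun s : ℝ => (((vary V ψ s x μ)⁻¹ : (Matrix n n ℂ)ˣ) : Matrix n n ℂ)) s := by
  simp only [vary, mul_inv_rev, Units.val_mul, val_inv_expUnit]
  have h : DifferentiableAt ℝ (fun s : ℝ => exp (-((s : ℂ) • ψ x μ))) s := by
    have h' := differentiableAt_exp_smul (-ψ x μ) s
    simp only [smul_neg] at h'
    exact h'
  exact h.mul_const _

/-- Each letter's bond variable along `V e^{sψ}` is differentiable in `s`. [folklore] -/
theorem differentiableAt_val_stepHol_vary (V : Site d → Fin d → (Matrix n n ℂ)ˣ)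
    (ψ : Site d → Fin d → Matrix n n ℂ) (x : Site d) (l : Letter d) (s : ℝ) :
    DifferentiableAt ℝ (fun s : ℝ => ((stepHol (vary V ψ s) x l : (Matrix n n ℂ)ˣ) : Matrix n n ℂ)) s := by
  obtain ⟨μ, b⟩ := l
  cases b
  · simp only [stepHol, Bool.false_eq_true, ↓reduceIte]
    exact differentiableAt_val_vary_inv V ψ _ μ s
  · simp only [stepHol, ↓reduceIte]
    exact differentiableAt_val_vary V ψ x μ s

/-- **Parallel transport (9) along any word is differentiable along `V e^{sψ}`.** [folklore] -/
theorem differentiableAt_val_hol_vary (V : Site d → Fin d → (Matrix n n ℂ)ˣ) (ψ : Site d → Fin d → Matrix n n ℂ)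
    (s : ℝ) : ∀ (w : List (Letter d)) (x : Site d),
    DifferentiableAt ℝ (fun s : ℝ => ((hol (vary V ψ s) x w : (Matrix n n ℂ)ˣ) : Matrix n n ℂ)) s
  | [], x => by
      simp only [hol_nil, Units.val_one]
      exact differentiableAt_const _
  | l :: w, x => by
      simp only [hol_cons, Units.val_mul]
      exact (differentiableAt_val_stepHol_vary V ψ x l s).mul (differentiableAt_val_hol_vary V ψ s w _)

/-- The loop variable `V_s(Γ_{c,x})V_s(c)⁻¹` of (42) is differentiable along `V e^{sψ}`. [folklore] -/
theorem differentiableAt_val_Wcx_vary (L : ℕ) (V : Site d → Fin d → (Matrix n n ℂ)ˣ)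
    (ψ : Site d → Fin d → Matrix n n ℂ) (q : Site d) (κ : Fin d) (r : Site d) (s : ℝ) :
    DifferentiableAt ℝ (fun s : ℝ => ((Wcx L (vary V ψ s) q κ r : (Matrix n n ℂ)ˣ) : Matrix n n ℂ)) s := by
  simp only [Wcx_eq_hol_loop]
  exact differentiableAt_val_hol_vary V ψ s _ _

/-- `log` of the loop variable (21)/(42) is differentiable at `s = 0` along `V e^{sψ}` whenever `V(Γ_{c,x})V(c)⁻¹` lies
in the analyticity ball `|· − 1| < 1` of the series (21) (`MatrixLog.analyticAt_mlog`). [folklore] -/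
theorem differentiableAt_mlog_Wcx_vary (L : ℕ) (V : Site d → Fin d → (Matrix n n ℂ)ˣ)
    (ψ : Site d → Fin d → Matrix n n ℂ) (q : Site d) (κ : Fin d) (r : Site d)
    (hW : ‖((Wcx L V q κ r : (Matrix n n ℂ)ˣ) : Matrix n n ℂ) - 1‖ < 1) :
    DifferentiableAt ℝ (fun s : ℝ => mlog ((Wcx L (vary V ψ s) q κ r : (Matrix n n ℂ)ˣ) : Matrix n n ℂ)) 0 := by
  have hg : DifferentiableAt ℝ (mlog : Matrix n n ℂ → Matrix n n ℂ)
      ((Wcx L (vary V ψ 0) q κ r : (Matrix n n ℂ)ˣ) : Matrix n n ℂ) := by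
    rw [vary_zero]
    exact ((analyticAt_mlog hW).differentiableAt).restrictScalars ℝ
  have h := hg.comp (0 : ℝ) (differentiableAt_val_Wcx_vary L V ψ q κ r 0)
  exact h

/-- The exponent `X_c` of (42) is differentiable at `s = 0` along `V e^{sψ}` (inside the ball). [folklore] -/
theorem differentiableAt_Xavg_vary (L : ℕ) (V : Site d → Fin d → (Matrix n n ℂ)ˣ)
    (ψ : Site d → Fin d → Matrix n n ℂ) (q : Site d) (κ : Fin d)
    (hW : ∀ r : Fin d → Fin L, ‖((Wcx L V q κ (boxVec L r) : (Matrix n n ℂ)ˣ) : Matrix n n ℂ) - 1‖ < 1) :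
    DifferentiableAt ℝ (fun s : ℝ => Xavg L (vary V ψ s) q κ) 0 := by
  unfold Xavg
  exact DifferentiableAt.fun_sum fun r _ =>
    (differentiableAt_mlog_Wcx_vary L V ψ q κ _ (hW r)).const_smul (((L : ℝ) ^ d)⁻¹)

/-- **The averaged bond variable `V̄_c` (42) is differentiable at `s = 0` along `V e^{sψ}`** (inside the ball).
[folklore] -/
theorem differentiableAt_val_bavg_vary (L : ℕ) (V : Site d → Fin d → (Matrix n n ℂ)ˣ)
    (ψ : Site d → Fin d → Matrix n n ℂ) (q : Site d) (κ : Fin d)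
    (hW : ∀ r : Fin d → Fin L, ‖((Wcx L V q κ (boxVec L r) : (Matrix n n ℂ)ˣ) : Matrix n n ℂ) - 1‖ < 1) :
    DifferentiableAt ℝ (fun s : ℝ => ((bavg L (vary V ψ s) q κ : (Matrix n n ℂ)ˣ) : Matrix n n ℂ)) 0 := by
  simp only [bavg, Units.val_mul, val_expUnit]
  exact (((NormedSpace.exp_analytic (𝕂 := ℝ) _).differentiableAt).comp (0 : ℝ)
    (differentiableAt_Xavg_vary L V ψ q κ hW)).mul (differentiableAt_val_hol_vary V ψ 0 _ _)

/-- … and so is its inverse `V̄_c⁻¹` (inversion is differentiable at units). [folklore] -/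
theorem differentiableAt_val_bavg_inv_vary (L : ℕ) (V : Site d → Fin d → (Matrix n n ℂ)ˣ)
    (ψ : Site d → Fin d → Matrix n n ℂ) (q : Site d) (κ : Fin d)
    (hW : ∀ r : Fin d → Fin L, ‖((Wcx L V q κ (boxVec L r) : (Matrix n n ℂ)ˣ) : Matrix n n ℂ) - 1‖ < 1) :
    DifferentiableAt ℝ (fun s : ℝ => (((bavg L (vary V ψ s) q κ)⁻¹ : (Matrix n n ℂ)ˣ) : Matrix n n ℂ)) 0 := by
  have h1 : DifferentiableAt ℝ (Ring.inverse : Matrix n n ℂ → Matrix n n ℂ)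
      ((bavg L (vary V ψ 0) q κ : (Matrix n n ℂ)ˣ) : Matrix n n ℂ) :=
    differentiableAt_inverse (𝕜 := ℝ) (Units.isUnit _)
  have h2 := h1.comp (0 : ℝ) (differentiableAt_val_bavg_vary L V ψ q κ hW)
  refine h2.congr_of_eventuallyEq (Filter.Eventually.of_forall fun s => ?_)
  simp only [Function.comp_apply, Ring.inverse_unit]

/-- **The coarse plaquette variable `V̄(∂P)` (44) of the averaged configuration is differentiable at `s = 0` along
`V e^{sψ}`** whenever all loop variables of (42) lie in the ball. [folklore] -/
theorem differentiableAt_val_chol_vary (L : ℕ) (V : Site d → Fin d → (Matrix n n ℂ)ˣ)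
    (ψ : Site d → Fin d → Matrix n n ℂ) (P : Plaq d)
    (hW : ∀ (q : Site d) (κ : Fin d) (r : Fin d → Fin L),
      ‖((Wcx L V q κ (boxVec L r) : (Matrix n n ℂ)ˣ) : Matrix n n ℂ) - 1‖ < 1) :
    DifferentiableAt ℝ (fun s : ℝ => ((chol L (vary V ψ s) P : (Matrix n n ℂ)ˣ) : Matrix n n ℂ)) 0 := by
  simp only [chol, cplaq, Units.val_mul]
  exact (((differentiableAt_val_bavg_vary L V ψ _ _ (hW _ _)).mul
    (differentiableAt_val_bavg_vary L V ψ _ _ (hW _ _))).mul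
    (differentiableAt_val_bavg_inv_vary L V ψ _ _ (hW _ _))).mul
    (differentiableAt_val_bavg_inv_vary L V ψ _ _ (hW _ _))

/-- The Wilson weight B11 (5) of a differentiable family of plaquette variables is differentiable. [folklore] -/
theorem differentiableAt_wt_comp {f : ℝ → (Matrix n n ℂ)ˣ}
    (hf : DifferentiableAt ℝ (fun s => ((f s : (Matrix n n ℂ)ˣ) : Matrix n n ℂ)) 0) :
    DifferentiableAt ℝ (fun s => wt (f s)) 0 := by
  have h := ((nReTrL (n := n)).differentiableAt.comp (0 : ℝ) hf).const_sub (1 : ℝ)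
  refine h.congr_of_eventuallyEq (Filter.Eventually.of_forall fun s => ?_)
  simp only [wt, Function.comp_apply, nReTrL_apply]

/-- **The coarse Wilson action of the averaged configuration is differentiable at `s = 0` along `V e^{sψ}`**
(all loop variables of (42) in the ball). [folklore] -/
theorem differentiableAt_coarseAction_vary (L : ℕ) (V : Site d → Fin d → (Matrix n n ℂ)ˣ)
    (ψ : Site d → Fin d → Matrix n n ℂ) (W : Finset (Plaq d))
    (hW : ∀ (q : Site d) (κ : Fin d) (r : Fin d → Fin L),
      ‖((Wcx L V q κ (boxVec L r) : (Matrix n n ℂ)ˣ) : Matrix n n ℂ) - 1‖ < 1) :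
    DifferentiableAt ℝ (fun s : ℝ => coarseAction L (vary V ψ s) W) 0 := by
  unfold coarseAction
  exact DifferentiableAt.fun_sum fun P _ => differentiableAt_wt_comp (differentiableAt_val_chol_vary L V ψ P hW)

/-- **THE DEFICIT IS DIFFERENTIABLE at `s = 0` along every perturbation `V e^{sψ}`** on every window pair, whenever
all loop variables of (42) lie in the analyticity ball of (21). [folklore] -/
theorem differentiableAt_deficit_vary (L : ℕ) (V : Site d → Fin d → (Matrix n n ℂ)ˣ)
    (ψ : Site d → Fin d → Matrix n n ℂ) (W : Finset (Plaq d) × Finset (Plaq d))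
    (hW : ∀ (q : Site d) (κ : Fin d) (r : Fin d → Fin L),
      ‖((Wcx L V q κ (boxVec L r) : (Matrix n n ℂ)ˣ) : Matrix n n ℂ) - 1‖ < 1) :
    DifferentiableAt ℝ (fun s : ℝ => deficit L (vary V ψ s) W) 0 := by
  unfold deficit
  exact ((differentiableAt_coarseAction_vary L V ψ W.1 hW).const_mul _).sub
    (hasDerivAt_fineAction_vary V ψ W.2).differentiableAt

/-- **INSIDE THE SMALL-FIELD CLASS ALL LOOP VARIABLES OF (42) LIE IN THE BALL**: for a `U(N)`-valued `V` with
(44) `|V(∂p) − 1| ≤ a` and `512(d+1)(d+4)L²·a ≤ 1`, `|V(Γ_{c,x})V(c)⁻¹ − 1| ≤ 16(d+1)(d+4)L²a ≤ 1/32 < 1` for every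
`L`-bond `c` and every `x ∈ B(c₋)` — `B7Prop2Explicit.norm_Wcx_sub_one_le` (p. 25) with `unitaryUnits ≤ U1`.
[cite: Balaban1985Averaging, p.25 (displays before (47))] -/
theorem norm_Wcx_sub_one_lt_one_of_smallField [Nonempty n] (L : ℕ) (hL : 1 ≤ L)
    {V : Site d → Fin d → (Matrix n n ℂ)ˣ} (hV : IsUnitaryCfg V) {a : ℝ} (ha : 0 ≤ a)
    (hsmall : 512 * (d + 1) * (d + 4) * (L : ℝ) ^ 2 * a ≤ 1) (hVa : SmallField V a)
    (q : Site d) (κ : Fin d) (r : Fin d → Fin L) :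
    ‖((Wcx L V q κ (boxVec L r) : (Matrix n n ℂ)ˣ) : Matrix n n ℂ) - 1‖ < 1 := by
  have hU : ∀ (x : Site d) (κ : Fin d), V x κ ∈ U1 (Matrix n n ℂ) := fun x κ =>
    ⟨(CStarRing.norm_of_mem_unitary (hV x κ)).le,
      (CStarRing.norm_of_mem_unitary ((unitaryUnits (Matrix n n ℂ)).inv_mem (hV x κ))).le⟩
  have h := norm_Wcx_sub_one_le L hL V hU ha hsmall hVa q κ r
  linarith

/-- **THE DERIVATIVE HYPOTHESIS OF (β) IS SATISFIABLE FOR EVERY ADMISSIBLE DATUM**: for every `U(N)`-valued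
configuration in the small-field class `|V(∂p) − 1| ≤ a` with `512(d+1)(d+4)L²a ≤ 1`, every direction field `ψ`
and every window pair `W`, the deficit `s ↦ 𝓓_W(V e^{sψ})` HAS a derivative at `s = 0`.  Consequently the typed wall
`DeficitDerivWall` constrains, for each such datum, the definite real number `deriv (s ↦ 𝓓_W(V e^{sψ})) 0`
(next theorem) — it is not satisfiable vacuously through a missing derivative. [folklore] -/
theorem exists_hasDerivAt_deficit_vary [Nonempty n] (L : ℕ) (hL : 1 ≤ L)
    {V : Site d → Fin d → (Matrix n n ℂ)ˣ} (hV : IsUnitaryCfg V) {a : ℝ} (ha : 0 ≤ a)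
    (hsmall : 512 * (d + 1) * (d + 4) * (L : ℝ) ^ 2 * a ≤ 1) (hVa : SmallField V a)
    (ψ : Site d → Fin d → Matrix n n ℂ) (W : Finset (Plaq d) × Finset (Plaq d)) :
    ∃ D : ℝ, HasDerivAt (fun s : ℝ => deficit L (vary V ψ s) W) D 0 :=
  ⟨_, (differentiableAt_deficit_vary L V ψ W
    (norm_Wcx_sub_one_lt_one_of_smallField L hL hV ha hsmall hVa)).hasDerivAt⟩

/-- **(β) BOUNDS THE ACTUAL DERIVATIVE**: under `DeficitDerivWall d N L C a₀ R`, for every admissible datum with in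
addition `512(d+1)(d+4)L²a ≤ 1` (so that the derivative exists, previous theorem), eventually along the window
filter `|deriv (s ↦ 𝓓_W(V e^{sψ})) 0| ≤ C·(‖∇_V F‖·‖d_Vψ‖ + a²(‖ψ‖₁ + ‖d_Vψ‖₁))` on `N_R(supp ψ)`. [folklore] -/
theorem DeficitDerivWall.deriv_bound [Nonempty n] {L : ℕ} (hL : 1 ≤ L) {C a₀ : ℝ} {R : ℕ}
    (hβ : DeficitDerivWall d n L C a₀ R) {V : Site d → Fin d → (Matrix n n ℂ)ˣ} (hV : IsUnitaryCfg V)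
    {a : ℝ} (ha : 0 ≤ a) (haa₀ : a ≤ a₀) (hsmall : 512 * (d + 1) * (d + 4) * (L : ℝ) ^ 2 * a ≤ 1)
    (hVa : SmallField V a) {ψ : Site d → Fin d → Matrix n n ℂ} {S : Finset (Bond d)} (hψ : IsSkewDir ψ)
    (hS : SupportedOn ψ S) :
    ∀ᶠ W in (atTop : Filter (Finset (Plaq d) × Finset (Plaq d))),
      |deriv (fun s : ℝ => deficit L (vary V ψ s) W) 0|
        ≤ C * (Real.sqrt (gradFluxSq V (nbhd R (bondSites S))) * Real.sqrt (curlSq V ψ (nbhd R (bondSites S)))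
          + a ^ 2 * (dirL1 ψ (nbhd R (bondSites S)) + curlL1 V ψ (nbhd R (bondSites S)))) :=
  (hβ V hV a ha haa₀ hVa ψ S hψ hS).mono fun W hW =>
    hW _ (differentiableAt_deficit_vary L V ψ W (norm_Wcx_sub_one_lt_one_of_smallField L hL hV ha hsmall hVa)).hasDerivAt

/-- **THE CONSUMABLE FORM OF `ClaimBeta`** (the shape NE3's (3.4) uses): if the wall holds at `(d, N, L)`, `L ≥ 1`,
then there are `C ≥ 0`, `a₁ > 0`, `R` such that for every `U(N)`-valued `V` with `|V(∂p) − 1| ≤ a ≤ a₁` on all of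
`ℤ^d` and every finitely supported skew direction field `ψ`, EVENTUALLY along the window filter the ACTUAL derivative
obeys `|d/ds|₀ 𝓓_W(V e^{sψ})| ≤ C·(‖∇_V F‖_{ℓ²(N_R)}·‖d_Vψ‖_{ℓ²(N_R)} + a²(‖ψ‖_{ℓ¹(N_R)} + ‖d_Vψ‖_{ℓ¹(N_R)}))`
(`a₁ = min(a₀, 1/(512(d+1)(d+4)L²))`, the second entry making every loop variable of (42) lie in the ball, so that
the derivative exists by `exists_hasDerivAt_deficit_vary`).  Nothing here asserts `ClaimBeta`. [folklore] -/
theorem ClaimBeta.deriv_bound [Nonempty n] {L : ℕ} (hL : 1 ≤ L) (h : ClaimBeta d n L) :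
    ∃ C a₁ : ℝ, ∃ R : ℕ, 0 ≤ C ∧ 0 < a₁ ∧
      ∀ V : Site d → Fin d → (Matrix n n ℂ)ˣ, IsUnitaryCfg V → ∀ a : ℝ, 0 ≤ a → a ≤ a₁ → SmallField V a →
        ∀ (ψ : Site d → Fin d → Matrix n n ℂ) (S : Finset (Bond d)), IsSkewDir ψ → SupportedOn ψ S →
          ∀ᶠ W in (atTop : Filter (Finset (Plaq d) × Finset (Plaq d))),
            |deriv (fun s : ℝ => deficit L (vary V ψ s) W) 0|
              ≤ C * (Real.sqrt (gradFluxSq V (nbhd R (bondSites S))) * Real.sqrt (curlSq V ψ (nbhd R (bondSites S)))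
                + a ^ 2 * (dirL1 ψ (nbhd R (bondSites S)) + curlL1 V ψ (nbhd R (bondSites S)))) := by
  obtain ⟨C, a₀, R, hC, ha₀, -, hβ, -⟩ := h
  have hL0 : (0 : ℝ) < L := by exact_mod_cast hL
  have hK : (0 : ℝ) < 512 * (d + 1) * (d + 4) * (L : ℝ) ^ 2 := by positivity
  refine ⟨C, min a₀ (1 / (512 * (d + 1) * (d + 4) * (L : ℝ) ^ 2)), R, hC, lt_min ha₀ (by positivity), ?_⟩
  intro V hV a ha ha₁ hVa ψ S hψ hS
  have haa₀ : a ≤ a₀ := ha₁.trans (min_le_left _ _)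
  have hsmall : 512 * (d + 1) * (d + 4) * (L : ℝ) ^ 2 * a ≤ 1 :=
    calc 512 * (d + 1) * (d + 4) * (L : ℝ) ^ 2 * a
        ≤ 512 * (d + 1) * (d + 4) * (L : ℝ) ^ 2 * (1 / (512 * (d + 1) * (d + 4) * (L : ℝ) ^ 2)) :=
          mul_le_mul_of_nonneg_left (ha₁.trans (min_le_right _ _)) hK.le
      _ = 1 := mul_one_div_cancel hK.ne'
  exact hβ.deriv_bound hL hV ha haa₀ hsmall hVa hψ hS

end

end Literature.MathematicalPhysics.QuantumFieldTheory.Balaban1983to89.T4AveragingDeficitWall
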